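import Summits.ResolutionOfSingularities.ResolutionOfSingularities.Theorems.RadicialJungCleanModelsCcurveRegResidue
import Literature.AlgebraicGeometry.Resolution.QuadraticSequenceDimOneExistence
import Literature.AlgebraicGeometry.Resolution.CurveDeltaDrop
import HarnessLib

/-!
# Route `RadicialJung`, crux `CleanModels` (stmt-15917) — (C-curve) sub-line, `curveRegularize` (classical route) V: the Herrmann–Ikeda–Orbanz data for a GIVEN
# valuation ring dominating a one-dimensional local domain with finite normalisation

Lead `res-B-lead-1` g7 (workfile `Lines/Sketch_Ccurve_assembly.lean` v2.9, S3-core `stub_Cc_curveRegularize`; classical, F-32-free route).  OURS · counted 0.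
Nothing here proves resolution in characteristic `p`; resolution in char `p` is NOT proved.

`hio_data_of_valuationSubring`: for a one-dimensional Noetherian local domain `A ⊆ L` with fraction field `L`, not a field, whose integral closure `N` is a finite
`A`-module, and ANY valuation ring `W` of `L` dominating `A`: `N ⊆ W`, `N` is generated over `A` by a finite set, and `W ⊆ N_{𝔪_W ∩ N}` — the hypotheses of
✓ `Literature.…exists_sequence_eq_valuationSubring` (the quadratic sequence of `A` along `W` reaches `W`).  This is ✓ `exists_valuationSubring_dominates_of_finite_integralClosure`
(Literature, which CHOOSES the valuation ring) for a prescribed `W`: with `Q = 𝔪_W ∩ N` (a maximal ideal of the Dedekind domain `N`, nonzero since `A` is not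
a field and `W` dominates `A`), the discrete valuation ring `N_Q ⊆ W` is a valuation ring of `L`, so every `z ∈ W` is `a/t` with `a, t ∈ N`, `t ∉ Q`.
-/

noncomputable section

set_option linter.dupNamespace false

open IsLocalRing Literature.AlgebraicGeometry.Resolution Literature.RingTheory.DiscreteValuationRing
open Summit.ResolutionOfSingularities.ResolutionOfSingularities.Theorems

namespace Summit.ResolutionOfSingularities.ResolutionOfSingularities.Theorems.RadicialJung.CleanModels.Ccurve

/-- **HIO data for a given dominating valuation ring** — see the module docstring. [folklore] -/
theorem hio_data_of_valuationSubring {L : Type} [Field L] {A : Subring L} [IsNoetherianRing ↥A] [Ring.KrullDimLE 1 ↥A]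
    (hof : IsLocalRingOf A) (hA : ¬ IsField ↥A) (hfin : Module.Finite ↥A ↥(integralClosure ↥A L))
    (W : ValuationSubring L) (hW : SubringDominates A W.toSubring) :
    ∃ (N : Subring L) (S : Finset L), N ≤ W.toSubring ∧ (S : Set L) ⊆ N ∧
      N ≤ Subring.closure ((A : Set L) ∪ ↑S) ∧ W.toSubring ≤ locAtCentre N W := by
  classical
  haveI : IsLocalRing ↥A := hof.1
  haveI : IsFractionRing ↥A L := isFractionRing_of_isLocalRingOf_le hof.2 le_rfl
  haveI : Ring.DimensionLEOne ↥A := dimensionLEOne_subring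
  haveI : IsDedekindDomain ↥(integralClosure ↥A L) :=
    KrullAkizuki_holds.isDedekindDomain_integralClosure hA L L
  -- `N ⊆ W`
  have hAW : ∀ a : ↥A, algebraMap ↥A L a ∈ W := fun a => hW.1 a.2
  have hNW : ∀ c : ↥(integralClosure ↥A L), (c : L) ∈ W := fun c =>
    integralClosure_le_valuationSubring (R := ↥A) W hAW (c : L) c.2
  have hle1 : ∀ c : ↥(integralClosure ↥A L), W.valuation (c : L) ≤ 1 := fun c => (W.valuation_le_one_iff _).mpr (hNW c)
  -- `Q = 𝔪_W ∩ N`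
  let Q : Ideal ↥(integralClosure ↥A L) :=
    { carrier := {c | W.valuation (c : L) < 1}
      add_mem' := fun {a b} ha hb => by
        change W.valuation ((a : L) + b) < 1
        exact lt_of_le_of_lt (Valuation.map_add _ _ _) (max_lt ha hb)
      zero_mem' := by change W.valuation ((0 : ↥(integralClosure ↥A L)) : L) < 1; simp
      smul_mem' := fun a b hb => by
        change W.valuation ((a : L) * b) < 1
        rw [map_mul]
        calc W.valuation (a : L) * W.valuation (b : L) ≤ 1 * W.valuation (b : L) := by gcongr; exact hle1 a
          _ < 1 := by rw [one_mul]; exact hb }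
  have hQmem : ∀ c : ↥(integralClosure ↥A L), c ∈ Q ↔ W.valuation (c : L) < 1 := fun c => Iff.rfl
  haveI hQprime : Q.IsPrime := by
    refine ⟨?_, fun {a b} hab => ?_⟩
    · rw [Ideal.ne_top_iff_one]
      change ¬ W.valuation ((1 : ↥(integralClosure ↥A L)) : L) < 1
      simp
    · rw [hQmem, Subalgebra.coe_mul, map_mul] at hab
      by_contra hcon
      push Not at hcon
      have ha : W.valuation (a : L) = 1 := le_antisymm (hle1 a) (not_lt.mp fun h => hcon.1 h)
      have hb : W.valuation (b : L) = 1 := le_antisymm (hle1 b) (not_lt.mp fun h => hcon.2 h)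
      rw [ha, hb, one_mul] at hab
      exact lt_irrefl _ hab
  -- `Q ≠ ⊥`: `A` is not a field and `W` dominates `A`
  have hQne : Q ≠ ⊥ := by
    obtain ⟨a, ham, ha0⟩ : ∃ a : ↥A, a ∈ maximalIdeal ↥A ∧ a ≠ 0 := by
      have hne : maximalIdeal ↥A ≠ ⊥ := Ring.ne_bot_of_isMaximal_of_not_isField (IsLocalRing.maximalIdeal.isMaximal _) hA
      obtain ⟨a, ha, ha0⟩ := Submodule.exists_mem_ne_zero_of_ne_bot hne
      exact ⟨a, ha, ha0⟩
    have ha0L : (a : L) ≠ 0 := fun h => ha0 (Subtype.ext h)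
    have hval : W.valuation (a : L) < 1 := by
      rw [valuation_lt_one_iff_inv_not_mem W ha0L]
      intro hinvW
      have hinvA : (a : L)⁻¹ ∈ A := hW.2 _ a.2 hinvW
      have hu : IsUnit a := (isUnit_subring_iff_inv_mem a).mpr ⟨ha0L, hinvA⟩
      exact ham hu
    intro hbot
    have : algebraMap ↥A ↥(integralClosure ↥A L) a ∈ Q := hval
    rw [hbot, Ideal.mem_bot] at this
    exact ha0L (congrArg (fun c : ↥(integralClosure ↥A L) => (c : L)) this)
  haveI hQmax : Q.IsMaximal := hQprime.isMaximal hQne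
  -- `N_Q ⊆ L`, a discrete valuation ring, hence a valuation ring of `L`
  let 𝒪 : Subalgebra ↥(integralClosure ↥A L) L :=
    Localization.subalgebra.ofField L Q.primeCompl Q.primeCompl_le_nonZeroDivisors
  haveI : IsLocalization.AtPrime 𝒪 Q := Localization.subalgebra.isLocalization_ofField L _ _
  haveI : IsDiscreteValuationRing 𝒪 :=
    IsLocalization.AtPrime.isDiscreteValuationRing_of_dedekind_domain _ hQne 𝒪
  have hC𝒪 : ∀ c : ↥(integralClosure ↥A L), (c : L) ∈ 𝒪 := fun c => 𝒪.algebraMap_mem c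
  have hA𝒪 : ∀ a : ↥A, (a : L) ∈ 𝒪 := fun a => hC𝒪 (algebraMap ↥A (integralClosure ↥A L) a)
  haveI : IsFractionRing 𝒪 L := by
    refine IsFractionRing.of_field 𝒪 L fun z => ?_
    obtain ⟨a, ha, b, hb, -, rfl⟩ := hof.2 z
    exact ⟨⟨a, hA𝒪 ⟨a, ha⟩⟩, ⟨b, hA𝒪 ⟨b, hb⟩⟩, rfl⟩
  have hmem_or : ∀ z : L, z ∈ 𝒪 ∨ z⁻¹ ∈ 𝒪 := by
    intro z
    rcases ValuationRing.isInteger_or_isInteger 𝒪 z with ⟨y, hy⟩ | ⟨y, hy⟩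
    · exact Or.inl (hy ▸ y.2)
    · exact Or.inr (hy ▸ y.2)
  -- every element of `N_Q` is `a / t` with `a, t ∈ N`, `t` a `W`-unit
  have hfrac𝒪 : ∀ z ∈ 𝒪, ∃ a t : ↥(integralClosure ↥A L), W.valuation (t : L) = 1 ∧ z = (a : L) / t := by
    intro z hz
    obtain ⟨a, t, ht, rfl⟩ := (show z ∈ 𝒪 from hz)
    have ht1 : W.valuation (t : L) = 1 := le_antisymm (hle1 t) (not_lt.mp fun h => ht h)
    exact ⟨a, t, ht1, by rw [div_eq_mul_inv]; rfl⟩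
  -- generators of `N` over `A`
  obtain ⟨s, hs⟩ := Module.Finite.fg_top (R := ↥A) (M := ↥(integralClosure ↥A L))
  refine ⟨(integralClosure ↥A L).toSubring, s.image (fun c : ↥(integralClosure ↥A L) => (c : L)), ?_, ?_, ?_, ?_⟩
  · intro c hc; exact hNW ⟨c, hc⟩
  · intro x hx
    rw [Finset.coe_image] at hx
    obtain ⟨c, -, rfl⟩ := hx
    exact c.2
  · have key : ∀ x ∈ Submodule.span ↥A (s : Set ↥(integralClosure ↥A L)),
        (x : L) ∈ Subring.closure ((A : Set L) ∪ ↑(s.image fun c : ↥(integralClosure ↥A L) => (c : L))) := by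
      intro x hx
      induction hx using Submodule.span_induction with
      | mem x hx =>
        refine Subring.subset_closure (Or.inr ?_)
        rw [Finset.coe_image]
        exact ⟨x, hx, rfl⟩
      | zero => exact Subring.zero_mem _
      | add x y _ _ hx hy => exact Subring.add_mem _ hx hy
      | smul a x _ hx =>
        change ((a : L) * (x : L)) ∈ _
        exact Subring.mul_mem _ (Subring.subset_closure (Or.inl a.2)) hx
    intro c hc
    have hcmem : (⟨c, hc⟩ : ↥(integralClosure ↥A L)) ∈ Submodule.span ↥A (s : Set ↥(integralClosure ↥A L)) := by
      rw [hs]; exact Submodule.mem_top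
    exact key _ hcmem
  · -- `W ⊆ N_{𝔪_W ∩ N}`: `N_Q` is a valuation ring inside `W`
    intro z hz
    have hzW : z ∈ W := hz
    rcases hmem_or z with h | h
    · obtain ⟨a, t, ht1, rfl⟩ := hfrac𝒪 z h
      exact ⟨(a : L), a.2, (t : L), t.2, ht1, rfl⟩
    · by_cases hz0 : z = 0
      · refine ⟨0, Subring.zero_mem _, 1, Subring.one_mem _, by simp, by rw [hz0]; simp⟩
      obtain ⟨a, t, ht1, hzinv⟩ := hfrac𝒪 z⁻¹ h
      have ha0 : (a : L) ≠ 0 := by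
        intro ha
        rw [ha, zero_div, inv_eq_zero] at hzinv
        exact hz0 hzinv
      have ha1 : W.valuation (a : L) = 1 := by
        rcases (hle1 a).lt_or_eq with hlt | heq
        · exfalso
          have hvinv : W.valuation z⁻¹ < 1 := by rw [hzinv, map_div₀, ht1, div_one]; exact hlt
          have hvz : W.valuation z ≤ 1 := (W.valuation_le_one_iff _).mpr hzW
          rw [map_inv₀, inv_lt_one₀ ((Valuation.pos_iff _).mpr hz0)] at hvinv
          exact not_lt.mpr hvz hvinv
        · exact heq
      refine ⟨(t : L), t.2, (a : L), a.2, ha1, ?_⟩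
      have : z = (z⁻¹)⁻¹ := (inv_inv z).symm
      rw [this, hzinv, inv_div]

end Summit.ResolutionOfSingularities.ResolutionOfSingularities.Theorems.RadicialJung.CleanModels.Ccurve

end
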